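import Literature.Claims.NS.Qiao2021
import Mathlib.Analysis.SpecialFunctions.SmoothTransition
import HarnessLib

/-!
# C39 `Qiao2021` (arXiv:2102.11873 v10, withdrawn in v11) — refuter's kernel kills of the two p. 23
# inferences of the proof of Theorem 5.1 (`Step_5a`, `Step_5b`)
(cell `ns-claims`, D-0090; refuter `ns-claims-refuter-7`; referee `ns-claims-ref-1 g2`; skeleton
`Literature.Claims.NS.Qiao2021` p476430 by typist-12 (co-typist; CARD/PREDICTION typist-1), whose INBOX line
2026-08-27T00:01:44Z pre-registered both countermodels below; barrier of the family:
`Literature/Barriers/NavierStokesRegularity/TimeTaylorFiniteRadius.lean` (salvage-p6, p469994))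

* `not_Step_5a` refutes `Literature.Claims.NS.Qiao2021.Step_5a` — p. 23, first inference of the proof of
  Thm 5.1: «Since v(x₀, t₀ − T/4) < ∞, −(t₀ − T/2) < t₀ − T/4, hence v(x₀, −(t₀ − T/2)) < ∞», i.e. Lemma 5.1
  (Abel) applied at `τ = t₀ − T/4 > T` where only FINITENESS of the (smooth) solution is known, as if it were
  CONVERGENCE OF THE t = 0 SERIES at `τ`; typed at the abstract power-series grain. WITNESS: `f(t) = 1/(1+t²)`
  (smooth on `ℝ`), `a_n = (−1)^{n/2}` for even `n`, `0` for odd `n` (so `Σ a_n tⁿ = f(t)` on `[0,½]`, radius 1),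
  `T = ½`, `τ = 2`: the terms `a_{2k} 2^{2k} = (−4)^k` do not tend to zero. [refuted-substantive]
* `not_Step_5b` refutes `Literature.Claims.NS.Qiao2021.Step_5b` — p. 23, the time shift: the restarted series
  evaluated at a NEGATIVE time is identified with the solution run backwards («ṽ(x₀, −t₀) = v(x₀, −(t₀ − T/2))
  < ∞»). WITNESS: `a ≡ 0`, `f(t) = expNegInvGlue(−t)` (smooth, `= 0` on `[0,∞)`, `> 0` on `(−∞,0)`), `T₀ = 1`,
  `s = −1`: the zero series converges at `s` but its sum `0 ≠ f(−1) > 0`. [refuted-substantive]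

WHAT THIS IS NOT: not a claim about the Navier–Stokes problem itself; not a claim about any author beyond
the typed locator.
-/

set_option linter.dupNamespace false

open Set Filter
open scoped ContDiff Topology

namespace Summit.NavierStokesRegularity.NavierStokesRegularity.Theorems.Qiao2021

open Literature.Claims.NS.Qiao2021

noncomputable section

/-! ## `Step_5a`: finiteness beyond the interval is not convergence of the series -/

/-- The coefficient sequence of `1/(1+t²) = Σ_k (−1)^k t^{2k}`: `(−1)^{n/2}` at even `n`, `0` at odd `n`. -/
def coeffA (n : ℕ) : ℝ := if Even n then (-1) ^ (n / 2) else 0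

/-- `t ↦ 1/(1+t²)` is smooth on `ℝ`. -/
theorem contDiff_inv_one_add_sq : ContDiff ℝ ∞ (fun t : ℝ => 1 / (1 + t ^ 2)) :=
  contDiff_const.div (contDiff_const.add (contDiff_id.pow 2)) fun t => by positivity

/-- On `|t| < 1` the series `Σ coeffA n · tⁿ` sums to `1/(1+t²)` (geometric series in `−t²`, transported
along `k ↦ 2k`). -/
theorem hasSum_coeffA {t : ℝ} (ht : |t| < 1) :
    HasSum (fun n : ℕ => coeffA n * t ^ n) (1 / (1 + t ^ 2)) := by
  have hr : |(-(t ^ 2))| < 1 := by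
    rw [abs_neg, abs_pow]
    have h0 : 0 ≤ |t| := abs_nonneg t
    nlinarith
  have hg := hasSum_geometric_of_abs_lt_one hr
  rw [show (1 - -(t ^ 2))⁻¹ = 1 / (1 + t ^ 2) by rw [sub_neg_eq_add, one_div]] at hg
  have hinj : Function.Injective (fun k : ℕ => 2 * k) := fun a b h => by simpa using h
  have hzero : ∀ n : ℕ, n ∉ Set.range (fun k : ℕ => 2 * k) → coeffA n * t ^ n = 0 := by
    intro n hn
    have hodd : ¬ Even n := by
      intro he
      obtain ⟨k, hk⟩ := he
      exact hn ⟨k, by simp [hk, two_mul]⟩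
    simp [coeffA, hodd]
  refine (hinj.hasSum_iff hzero).1 ?_
  have hcomp : (fun n : ℕ => coeffA n * t ^ n) ∘ (fun k : ℕ => 2 * k) = fun k : ℕ => (-(t ^ 2)) ^ k := by
    funext k
    simp only [Function.comp, coeffA, even_two_mul, if_true]
    rw [Nat.mul_div_cancel_left k (by norm_num : 0 < 2), pow_mul, ← neg_pow]
  rw [hcomp]
  exact hg

/-- At `τ = 2` the series `Σ coeffA n · 2ⁿ` diverges: its even-indexed terms are `(−4)^k`. -/
theorem not_summable_coeffA_two : ¬ Summable (fun n : ℕ => coeffA n * (2 : ℝ) ^ n) := by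
  intro h
  have h0 := h.tendsto_atTop_zero
  have hev : ∀ᶠ n : ℕ in atTop, |coeffA n * (2 : ℝ) ^ n| < 1 := by
    have := h0.abs
    rw [abs_zero] at this
    exact this.eventually (gt_mem_nhds zero_lt_one)
  obtain ⟨N, hN⟩ := hev.exists_forall_of_atTop
  have hbad := hN (2 * N) (by omega)
  have hval : |coeffA (2 * N) * (2 : ℝ) ^ (2 * N)| = 4 ^ N := by
    simp only [coeffA, even_two_mul, if_true]
    rw [Nat.mul_div_cancel_left N (by norm_num : 0 < 2), abs_mul, abs_pow, abs_neg, abs_one, one_pow,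
      one_mul, abs_pow, abs_two, pow_mul]
    norm_num
  rw [hval] at hbad
  have : (1 : ℝ) ≤ 4 ^ N := one_le_pow₀ (by norm_num)
  linarith

/-- **Refutes `Qiao2021.Step_5a` — p. 23, first inference of the proof of Thm 5.1 [refuted-substantive]**:
`f = 1/(1+t²)` is smooth on `ℝ` and is the sum of its power series on `[0,½]`, yet that series diverges at
`τ = 2 > ½`: finiteness (indeed smoothness) of `f` at `τ` is not convergence of the `t = 0` series there. No
cheap repair: this is exactly the use the proof makes of Lemma 5.1 (at `τ = t₀ − T/4 > T`), and the radius of a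
real-analytic function's series is governed by COMPLEX singularities (`±i` here), invisible to finiteness on
the real line; for the heat/NS time series the radius at `t = 0` is finite already for Gaussian data
(`TimeTaylorFiniteRadius`). [cite: QiaoYanyou2022, proof of Thm 5.1 p. 23; Lemma 5.1 p. 22] -/
theorem not_Step_5a : ¬ Literature.Claims.NS.Qiao2021.Step_5a := by
  intro h
  have hser : ∀ t ∈ Icc (0 : ℝ) (1 / 2), HasSum (fun n : ℕ => coeffA n * t ^ n) (1 / (1 + t ^ 2)) := by
    intro t ht
    exact hasSum_coeffA (abs_lt.2 ⟨by linarith [ht.1], by linarith [ht.2]⟩)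
  exact not_summable_coeffA_two
    (h coeffA (fun t => 1 / (1 + t ^ 2)) (1 / 2) 2 (by norm_num) (by norm_num) contDiff_inv_one_add_sq hser)

/-! ## `Step_5b`: a series restarted at `T/2` says nothing about negative times -/

/-- **Refutes `Qiao2021.Step_5b` — p. 23, the time shift [refuted-substantive]**: `f(t) = expNegInvGlue(−t)`
is smooth, vanishes on `[0,∞)` — so the ZERO series sums to `f` on `[0,1]` and converges everywhere — but
`f(−1) = expNegInvGlue 1 > 0 ≠ 0`: wherever the restarted series converges at a negative time, it need not
sum to the function there. No cheap repair: identifying `ṽ(·,−s)` with the solution run backwards needs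
time-analyticity across `t = 0` of the restarted problem, which is the very point in dispute (and false for
the heat part). [cite: QiaoYanyou2022, proof of Thm 5.1 p. 23, (5.1)–(5.3)] -/
theorem not_Step_5b : ¬ Literature.Claims.NS.Qiao2021.Step_5b := by
  intro h
  have hf : ContDiff ℝ ∞ (fun t : ℝ => expNegInvGlue (-t)) := expNegInvGlue.contDiff.comp contDiff_neg
  have hser : ∀ t ∈ Icc (0 : ℝ) 1, HasSum (fun n : ℕ => (0 : ℝ) * t ^ n) (expNegInvGlue (-t)) := by
    intro t ht
    rw [expNegInvGlue.zero_of_nonpos (by linarith [ht.1])]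
    simp
  have hsum : Summable (fun n : ℕ => (0 : ℝ) * (-1 : ℝ) ^ n) := by
    simp
  have hS := h (fun _ => 0) (fun t => expNegInvGlue (-t)) 1 (-1) one_pos (by norm_num) hf hser hsum
  have hzero : HasSum (fun n : ℕ => (0 : ℝ) * (-1 : ℝ) ^ n) 0 := by
    simp
  have heq : expNegInvGlue (-(-1 : ℝ)) = 0 := hS.unique hzero
  have hpos : 0 < expNegInvGlue (-(-1 : ℝ)) := expNegInvGlue.pos_of_pos (by norm_num)
  linarith

end

end Summit.NavierStokesRegularity.NavierStokesRegularity.Theorems.Qiao2021
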